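import Mathlib
import Literature.Computability.AlgebraicComplexity.BorderApolarityLimits
import Literature.Computability.AlgebraicComplexity.TensorApolarityForms
import Literature.Computability.AlgebraicComplexity.BorderApolarityWeak

/-!
# Fat border apolarity for `⟨3,3,3⟩` — support file B: forms of weight `m`, the limit pieces
# `I_m = lim I(Γ_ε)_m` and `J_m = lim I(2Γ_ε)_m`

Crux `stmt-MatrixMultiplication-4958` (`FidelityWitnesses.FidelityGapThreeSeventeen`), line
`symbolic-square-border-apolarity`, stub `stub_fatBorderApolarity` (helper file; general, reusable).

For a block-multigraded polynomial ring `K[x_σ]` (weights `w : σ → ℕ^ι` with `∑_l w v l = 1`), `r` moving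
points `p_ρ(ε) ∈ K[ε]^σ` and a multidegree `m`, in the tree's `limSub` technology
(`BorderApolarityLimits.lean`):

* `vanGen L P` — the `L`-subspace of coefficient vectors annihilated by a family of `K[ε]`-valued
  functionals indexed by an arbitrary finite type, `mem_latt_vanGen_iff`, `card_le_finrank_vanGen_add`;
* `Mon w m`, `form` — monomials of weight `m`, coefficient vectors versus forms
  (`finrank_weightedHomogeneousSubmodule_eq_card : dim S_m = #Mon`);
* `valMat`, `jetMat` — the value and the jet (values and first partials) matrices of the points;
* `Ilim`, `Jlim` — **`I_m = lim_{ε→0} I(Γ_ε)_m`, `J_m = lim_{ε→0} I(2Γ_ε)_m`** pulled back into the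
  polynomial ring, with the polynomial-level membership criteria `mem_Ilim_iff`, `mem_Jlim_iff`, the
  product rules `Ilim_mul_le` (`I_d · S_e ≤ I_{d+e}`, CHL §2.3 (iii)) and `Ilim_mul_Ilim_le`
  (`I_d · I_e ≤ J_{d+e}` — THE SYMBOLIC-SQUARE LAYER: a product of two forms vanishing at a point
  vanishes doubly there, Leibniz), and `finrank_Ilim`, `finrank_Jlim` (`= dim_L` of the `K(ε)`-spaces, by
  `finrank_limSub_eq`).

References: W. Buczyńska, J. Buczyński, Duke Math. J. 170 (2021), Thm. 1.2; A. Conner, A. Harper,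
J. M. Landsberg, Forum Math. Pi 11 (2023) e17 = arXiv:1911.07981, §2.3 (i)–(iii).
-/

noncomputable section

namespace Summit.MatrixMultiplication.MatrixMultiplication.Theorems.SymbolicSquare.FatBorder

-- single-conjunct summit: the `Summit.<S>.<P>` prefix repeats `MatrixMultiplication` by design (D-0017)
set_option linter.dupNamespace false

open scoped BigOperators Polynomial
open Polynomial Module
open Literature.Computability.AlgebraicComplexity
open Literature.Computability.AlgebraicComplexity.TensorApolarity

universe u

/-! ## Vanishing loci of general functional families over `L = K(ε)` -/

section VanGen

variable {K : Type u} [Field K] (L : Type u) [Field L] [Algebra K[X] L]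
variable {Λ n : Type} [Fintype Λ] [Fintype n]

/-- The `L`-subspace of coefficient vectors `f : n → L` annihilated by the functionals
`f ↦ ∑_s f_s P_ℓ(s)`, `ℓ ∈ Λ` (a reindexing of the tree's `vanishingL`). [cite: ConnerHarperLandsberg2023, §2.3] -/
def vanGen (P : Λ → n → K[X]) : Submodule L (n → L) :=
  vanishingL L (fun i : Fin (Fintype.card Λ) => P ((Fintype.equivFin Λ).symm i))

/-- `|n| ≤ dim_L vanGen + |Λ|`: at most `|Λ|` conditions are imposed. [folklore] -/
theorem card_le_finrank_vanGen_add (P : Λ → n → K[X]) :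
    Fintype.card n ≤ finrank L (vanGen L P) + Fintype.card Λ :=
  card_le_finrank_vanishingL_add L _

omit [Fintype n] in
/-- `ev0` is `constantCoeff` coordinatewise. [folklore] -/
theorem ev0_eq (g : n → K[X]) : ev0ₗ (K := K) g = fun d => Polynomial.constantCoeff (g d) := by
  funext d; simp

omit [Fintype Λ] [Fintype n] in
/-- Constant coefficient extension preserves weights. [folklore] -/
theorem map_C_mem {σ ι : Type*} {w : σ → ι → ℕ} {e : ι → ℕ} {g : MvPolynomial σ K}
    (hg : g ∈ MvPolynomial.weightedHomogeneousSubmodule K w e) :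
    MvPolynomial.map (Polynomial.C : K →+* K[X]) g ∈
      MvPolynomial.weightedHomogeneousSubmodule K[X] w e := by
  intro d hd
  rw [MvPolynomial.coeff_map] at hd
  exact hg fun h => hd (by rw [h, map_zero])

omit [Fintype Λ] [Fintype n] in
/-- `(map C g)(0) = g`. [folklore] -/
theorem map_constantCoeff_map_C {σ : Type*} (g : MvPolynomial σ K) :
    MvPolynomial.map Polynomial.constantCoeff (MvPolynomial.map (Polynomial.C : K →+* K[X]) g) = g := by
  rw [MvPolynomial.map_map]
  have : (Polynomial.constantCoeff : K[X] →+* K).comp Polynomial.C = RingHom.id K := by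
    ext; simp
  rw [this, MvPolynomial.map_id]

variable [IsFractionRing K[X] L]

/-- A polynomial vector lies in the lattice of `vanGen` iff all functionals vanish on it over `K[ε]`.
[folklore] -/
theorem mem_latt_vanGen_iff {P : Λ → n → K[X]} {f : n → K[X]} :
    f ∈ latt K L (vanGen L P) ↔ ∀ ℓ, ∑ s, f s * P ℓ s = 0 := by
  rw [vanGen, mem_latt_vanishingL_iff]
  constructor
  · intro h ℓ
    simpa using h (Fintype.equivFin Λ ℓ)
  · intro h i
    exact h _

end VanGen

/-! ## Forms of weight `m`: monomials, coefficient vectors, value and jet matrices, limits -/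

section Forms

variable {K : Type u} [Field K]
variable {σ ι : Type} [Fintype σ] [Fintype ι]
variable (w : σ → ι → ℕ) (m : ι → ℕ)

/-- The monomials of weight `m` (with the total-degree bound `|d| ≤ ∑ m`, redundant for a block
grading, which makes finiteness unconditional). [folklore] -/
def monSet : Set (σ →₀ ℕ) := {d | d.degree ≤ ∑ l, m l ∧ Finsupp.weight w d = m}

omit [Fintype σ] in
/-- There are finitely many monomials of weight `m`. [folklore] -/
theorem monSet_finite [Finite σ] : (monSet w m).Finite :=
  (Finsupp.finite_of_degree_le (∑ l, m l)).subset fun _ hd => hd.1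

/-- The finite type of monomials of weight `m`. [folklore] -/
abbrev Mon : Type := ↥(monSet w m)

/-- `Mon w m` is finite. [folklore] -/
instance instFintypeMon : Fintype (Mon w m) := (monSet_finite w m).fintype

/-- For a BLOCK grading (`∑_l w v l = 1` for every variable `v`) the total degree of a monomial is
the total of its weight. [folklore] -/
theorem degree_eq_sum_weight (hw : ∀ v, ∑ l, w v l = 1) (d : σ →₀ ℕ) :
    d.degree = ∑ l, Finsupp.weight w d l := by
  classical
  rw [Finsupp.degree_eq_sum, Finsupp.weight_apply, Finsupp.sum_fintype _ _ (by simp)]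
  simp_rw [Finset.sum_apply, Pi.smul_apply, smul_eq_mul]
  rw [Finset.sum_comm]
  refine Finset.sum_congr rfl fun v _ => ?_
  rw [← Finset.mul_sum, hw v, mul_one]

/-- For a block grading, `Mon w m` is exactly the set of monomials of weight `m`. [folklore] -/
theorem mem_monSet_iff (hw : ∀ v, ∑ l, w v l = 1) {d : σ →₀ ℕ} :
    d ∈ monSet w m ↔ Finsupp.weight w d = m := by
  refine ⟨fun h => h.2, fun h => ⟨?_, h⟩⟩
  rw [degree_eq_sum_weight w hw d, h]

variable (R : Type*) [CommSemiring R]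

/-- Coefficient vector `↦` form: `f ↦ ∑_d f_d x^d`. [folklore] -/
def form : (Mon w m → R) →ₗ[R] MvPolynomial σ R where
  toFun f := ∑ d, MvPolynomial.monomial d.1 (f d)
  map_add' f g := by simp [Finset.sum_add_distrib]
  map_smul' c f := by
    simp only [Pi.smul_apply, smul_eq_mul, RingHom.id_apply, Finset.smul_sum, MvPolynomial.smul_monomial]

variable {R}

/-- Coefficients of `form f` on `Mon w m`. [folklore] -/
theorem coeff_form (f : Mon w m → R) (d : Mon w m) :
    MvPolynomial.coeff d.1 (form w m R f) = f d := by
  classical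
  simp only [form, LinearMap.coe_mk, AddHom.coe_mk, MvPolynomial.coeff_sum, MvPolynomial.coeff_monomial]
  rw [Finset.sum_eq_single d]
  · simp
  · intro d' _ hd
    rw [if_neg]
    exact fun h' => hd (Subtype.ext h')
  · intro h'
    exact absurd (Finset.mem_univ _) h'

/-- Coefficients of `form f` off `Mon w m` vanish. [folklore] -/
theorem coeff_form_of_not_mem (f : Mon w m → R) {e : σ →₀ ℕ} (h : e ∉ monSet w m) :
    MvPolynomial.coeff e (form w m R f) = 0 := by
  classical
  simp only [form, LinearMap.coe_mk, AddHom.coe_mk, MvPolynomial.coeff_sum, MvPolynomial.coeff_monomial]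
  refine Finset.sum_eq_zero fun d _ => ?_
  rw [if_neg]
  exact fun h' => h (h' ▸ d.2)

/-- `form f` has weight `m`. [folklore] -/
theorem form_mem (f : Mon w m → R) : form w m R f ∈ MvPolynomial.weightedHomogeneousSubmodule R w m :=
  Submodule.sum_mem _ fun d _ => MvPolynomial.isWeightedHomogeneous_monomial w d.1 (f d) d.2.2

/-- `form` is injective. [folklore] -/
theorem form_injective : Function.Injective (form w m R) := by
  intro f g h
  funext d
  have := congrArg (MvPolynomial.coeff d.1) h
  rwa [coeff_form, coeff_form] at this

/-- A form of weight `m` is `form` of its coefficient vector (block grading). [folklore] -/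
theorem form_coeff (hw : ∀ v, ∑ l, w v l = 1) {F : MvPolynomial σ R}
    (hF : F ∈ MvPolynomial.weightedHomogeneousSubmodule R w m) :
    form w m R (fun d => MvPolynomial.coeff d.1 F) = F := by
  classical
  ext e
  by_cases h : e ∈ monSet w m
  · exact coeff_form w m _ ⟨e, h⟩
  · rw [coeff_form_of_not_mem w m _ h]
    by_contra hne
    exact h ((mem_monSet_iff w m hw).2 (hF (Ne.symm hne)))

/-- `form` commutes with a change of coefficients. [folklore] -/
theorem map_form {S : Type*} [CommSemiring S] (φ : R →+* S) (f : Mon w m → R) :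
    MvPolynomial.map φ (form w m R f) = form w m S (fun d => φ (f d)) := by
  simp [form, MvPolynomial.map_monomial]

/-- The range of `form` is the whole piece `S_m` (block grading). [folklore] -/
theorem range_form (hw : ∀ v, ∑ l, w v l = 1) :
    LinearMap.range (form w m R) = MvPolynomial.weightedHomogeneousSubmodule R w m := by
  refine le_antisymm ?_ fun F hF => ⟨_, form_coeff w m hw hF⟩
  rintro _ ⟨f, rfl⟩
  exact form_mem w m f

/-- **`dim S_m` is the number of monomials of weight `m`** (block grading). [folklore] -/
theorem finrank_weightedHomogeneousSubmodule_eq_card (hw : ∀ v, ∑ l, w v l = 1) :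
    finrank K (MvPolynomial.weightedHomogeneousSubmodule K w m) = Fintype.card (Mon w m) := by
  rw [← range_form w m hw, LinearMap.finrank_range_of_inj (form_injective w m),
    finrank_fintype_fun_eq_card]

/-- Evaluating `form f` at a point. [folklore] -/
theorem eval_form (f : Mon w m → R) (y : σ → R) :
    MvPolynomial.eval y (form w m R f) = ∑ d, f d * MvPolynomial.eval y (MvPolynomial.monomial d.1 1) := by
  simp [form, map_sum, MvPolynomial.eval_monomial]

/-- Evaluating a first partial of `form f` at a point. [folklore] -/
theorem eval_pderiv_form (f : Mon w m → R) (y : σ → R) (v : σ) :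
    MvPolynomial.eval y (MvPolynomial.pderiv v (form w m R f)) =
      ∑ d, f d * MvPolynomial.eval y (MvPolynomial.pderiv v (MvPolynomial.monomial d.1 1)) := by
  simp only [form, LinearMap.coe_mk, AddHom.coe_mk, map_sum, MvPolynomial.pderiv_monomial,
    MvPolynomial.eval_monomial]
  refine Finset.sum_congr rfl fun d _ => ?_
  ring

variable {r : ℕ} (p : Fin r → σ → K[X])

/-- The VALUE matrix of the `r` moving points on the monomials of weight `m`.
[cite: ConnerHarperLandsberg2023, §2.3] -/
def valMat : Fin r → Mon w m → K[X] := fun ρ d => MvPolynomial.eval (p ρ) (MvPolynomial.monomial d.1 1)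

/-- The JET matrix (values and all first partials) of the `r` moving points on the monomials of
weight `m`. [folklore] -/
def jetMat : Fin r × Option σ → Mon w m → K[X] := fun ℓ d =>
  match ℓ.2 with
  | none => MvPolynomial.eval (p ℓ.1) (MvPolynomial.monomial d.1 1)
  | some v => MvPolynomial.eval (p ℓ.1) (MvPolynomial.pderiv v (MvPolynomial.monomial d.1 1))

/-- Rows of the value matrix are values of forms. [folklore] -/
theorem sum_mul_valMat (f : Mon w m → K[X]) (ρ : Fin r) :
    ∑ d, f d * valMat w m p ρ d = MvPolynomial.eval (p ρ) (form w m K[X] f) := by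
  rw [eval_form]; rfl

/-- Value rows of the jet matrix. [folklore] -/
theorem sum_mul_jetMat_none (f : Mon w m → K[X]) (ρ : Fin r) :
    ∑ d, f d * jetMat w m p (ρ, none) d = MvPolynomial.eval (p ρ) (form w m K[X] f) := by
  rw [eval_form]; rfl

/-- Derivative rows of the jet matrix. [folklore] -/
theorem sum_mul_jetMat_some (f : Mon w m → K[X]) (ρ : Fin r) (v : σ) :
    ∑ d, f d * jetMat w m p (ρ, some v) d =
      MvPolynomial.eval (p ρ) (MvPolynomial.pderiv v (form w m K[X] f)) := by
  rw [eval_pderiv_form]; rfl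

variable (K)

/-- **`I_m := lim_{ε→0} I(Γ_ε)_m`**, the limit of the forms of weight `m` vanishing at the `r` moving
points, as a subspace of the polynomial ring. [cite: ConnerHarperLandsberg2023, §2.3] -/
def Ilim : Submodule K (MvPolynomial σ K) :=
  (limSub K (FractionRing K[X]) (vanGen (FractionRing K[X]) (valMat w m p))).map (form w m K)

/-- **`J_m := lim_{ε→0} I(2Γ_ε)_m`**, the limit of the forms of weight `m` vanishing DOUBLY at the `r`
moving points. [folklore] -/
def Jlim : Submodule K (MvPolynomial σ K) :=
  (limSub K (FractionRing K[X]) (vanGen (FractionRing K[X]) (jetMat w m p))).map (form w m K)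

variable {K w m p}

/-- `I_m ≤ S_m`. [folklore] -/
theorem Ilim_le : Ilim K w m p ≤ MvPolynomial.weightedHomogeneousSubmodule K w m := by
  rintro _ ⟨y, -, rfl⟩
  exact form_mem w m y

/-- `J_m ≤ S_m`. [folklore] -/
theorem Jlim_le : Jlim K w m p ≤ MvPolynomial.weightedHomogeneousSubmodule K w m := by
  rintro _ ⟨y, -, rfl⟩
  exact form_mem w m y

/-- **Membership in `I_m` at the level of polynomials**: `f ∈ I_m` iff `f = F(0)` for a form `F` of
weight `m` over `K[ε]` vanishing at the moving points. [cite: ConnerHarperLandsberg2023, §2.3] -/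
theorem mem_Ilim_iff (hw : ∀ v, ∑ l, w v l = 1) {f : MvPolynomial σ K} :
    f ∈ Ilim K w m p ↔ ∃ F : MvPolynomial σ K[X],
      F ∈ MvPolynomial.weightedHomogeneousSubmodule K[X] w m ∧
      (∀ ρ, MvPolynomial.eval (p ρ) F = 0) ∧ MvPolynomial.map Polynomial.constantCoeff F = f := by
  constructor
  · rintro ⟨y, hy, rfl⟩
    obtain ⟨g, hg, rfl⟩ := (mem_limSub_iff (K := K) (FractionRing K[X])).1 hy
    refine ⟨form w m K[X] g, form_mem w m g, fun ρ => ?_, ?_⟩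
    · rw [← sum_mul_valMat]
      exact (mem_latt_vanGen_iff (FractionRing K[X])).1 hg ρ
    · rw [map_form, ev0_eq]
  · rintro ⟨F, hF, hF0, rfl⟩
    set g : Mon w m → K[X] := fun d => MvPolynomial.coeff d.1 F
    have hFg : form w m K[X] g = F := form_coeff w m hw hF
    refine ⟨ev0ₗ g, (mem_limSub_iff (K := K) (FractionRing K[X])).2 ⟨g, ?_, rfl⟩, ?_⟩
    · exact (mem_latt_vanGen_iff (FractionRing K[X])).2 fun ρ => by rw [sum_mul_valMat, hFg, hF0]
    · rw [← hFg, map_form, ev0_eq]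

/-- **Membership in `J_m`**: `f = F(0)` for a form `F` of weight `m` over `K[ε]` vanishing at the
moving points together with all its first partials. [folklore] -/
theorem mem_Jlim_iff (hw : ∀ v, ∑ l, w v l = 1) {f : MvPolynomial σ K} :
    f ∈ Jlim K w m p ↔ ∃ F : MvPolynomial σ K[X],
      F ∈ MvPolynomial.weightedHomogeneousSubmodule K[X] w m ∧
      (∀ ρ, MvPolynomial.eval (p ρ) F = 0) ∧
      (∀ ρ v, MvPolynomial.eval (p ρ) (MvPolynomial.pderiv v F) = 0) ∧
      MvPolynomial.map Polynomial.constantCoeff F = f := by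
  constructor
  · rintro ⟨y, hy, rfl⟩
    obtain ⟨g, hg, rfl⟩ := (mem_limSub_iff (K := K) (FractionRing K[X])).1 hy
    have hg' := (mem_latt_vanGen_iff (FractionRing K[X])).1 hg
    refine ⟨form w m K[X] g, form_mem w m g, fun ρ => ?_, fun ρ v => ?_, ?_⟩
    · rw [← sum_mul_jetMat_none]
      exact hg' (ρ, none)
    · rw [← sum_mul_jetMat_some]
      exact hg' (ρ, some v)
    · rw [map_form, ev0_eq]
  · rintro ⟨F, hF, hF0, hF1, rfl⟩
    set g : Mon w m → K[X] := fun d => MvPolynomial.coeff d.1 F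
    have hFg : form w m K[X] g = F := form_coeff w m hw hF
    refine ⟨ev0ₗ g, (mem_limSub_iff (K := K) (FractionRing K[X])).2 ⟨g, ?_, rfl⟩, ?_⟩
    · refine (mem_latt_vanGen_iff (FractionRing K[X])).2 ?_
      rintro ⟨ρ, _ | v⟩
      · rw [sum_mul_jetMat_none, hFg, hF0]
      · rw [sum_mul_jetMat_some, hFg, hF1]
    · rw [← hFg, map_form, ev0_eq]

/-- **`I_d · S_e ≤ I_{d+e}`** (CHL (iii): the limit pieces are closed under multiplication by forms).
[cite: ConnerHarperLandsberg2023, §2.3] -/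
theorem Ilim_mul_le (hw : ∀ v, ∑ l, w v l = 1) (d e : ι → ℕ) :
    Ilim K w d p * MvPolynomial.weightedHomogeneousSubmodule K w e ≤ Ilim K w (d + e) p := by
  rw [Submodule.mul_le]
  intro f hf g hg
  obtain ⟨F, hF, hF0, rfl⟩ := (mem_Ilim_iff hw).1 hf
  refine (mem_Ilim_iff hw).2 ⟨F * MvPolynomial.map Polynomial.C g, ?_, fun ρ => ?_, ?_⟩
  · exact MvPolynomial.weightedHomogeneousSubmodule_mul w d e (Submodule.mul_mem_mul hF (map_C_mem hg))
  · rw [map_mul, hF0 ρ, zero_mul]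
  · rw [map_mul, map_constantCoeff_map_C]

/-- **`I_d · I_e ≤ J_{d+e}`** — THE SYMBOLIC-SQUARE LAYER: a product of two forms vanishing at the
moving points vanishes doubly there (Leibniz), and limits of products are products of limits.
[folklore] -/
theorem Ilim_mul_Ilim_le (hw : ∀ v, ∑ l, w v l = 1) (d e : ι → ℕ) :
    Ilim K w d p * Ilim K w e p ≤ Jlim K w (d + e) p := by
  rw [Submodule.mul_le]
  intro f hf g hg
  obtain ⟨F, hF, hF0, rfl⟩ := (mem_Ilim_iff hw).1 hf
  obtain ⟨G, hG, hG0, rfl⟩ := (mem_Ilim_iff hw).1 hg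
  refine (mem_Jlim_iff hw).2 ⟨F * G, ?_, fun ρ => ?_, fun ρ v => ?_, by rw [map_mul]⟩
  · exact MvPolynomial.weightedHomogeneousSubmodule_mul w d e (Submodule.mul_mem_mul hF hG)
  · rw [map_mul, hF0 ρ, zero_mul]
  · rw [MvPolynomial.pderiv_mul, map_add, map_mul, map_mul, hF0, hG0, mul_zero, zero_mul, add_zero]

/-- `dim_K I_m = dim_L I(Γ_ε)_m`. [cite: ConnerHarperLandsberg2023, §2.3] -/
theorem finrank_Ilim : finrank K (Ilim K w m p) =
    finrank (FractionRing K[X]) (vanGen (FractionRing K[X]) (valMat w m p)) := by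
  rw [Ilim, ← finrank_limSub_eq K (FractionRing K[X])]
  exact (Submodule.equivMapOfInjective _ (form_injective w m) _).finrank_eq.symm

/-- `dim_K J_m = dim_L I(2Γ_ε)_m`. [folklore] -/
theorem finrank_Jlim : finrank K (Jlim K w m p) =
    finrank (FractionRing K[X]) (vanGen (FractionRing K[X]) (jetMat w m p)) := by
  rw [Jlim, ← finrank_limSub_eq K (FractionRing K[X])]
  exact (Submodule.equivMapOfInjective _ (form_injective w m) _).finrank_eq.symm

/-- **Registered sub-goal `stub_fatBorderApolarity_symbolicSquare` of `stub_fatBorderApolarity`** (closed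
form of `Ilim_mul_Ilim_le` over `ℂ`): THE SYMBOLIC-SQUARE LAYER `I_d · I_e ≤ J_{d+e}`. [folklore] -/
theorem stub_fatBorderApolarity_symbolicSquare :
    ∀ (σ ι : Type) [Fintype σ] [Fintype ι] (w : σ → ι → ℕ), (∀ v, ∑ l, w v l = 1) →
      ∀ (r : ℕ) (p : Fin r → σ → Polynomial ℂ) (d e : ι → ℕ),
        Ilim ℂ w d p * Ilim ℂ w e p ≤ Jlim ℂ w (d + e) p :=
  fun _ _ _ _ _ hw _ _ d e => Ilim_mul_Ilim_le hw d e

end Forms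

end Summit.MatrixMultiplication.MatrixMultiplication.Theorems.SymbolicSquare.FatBorder

end
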